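import Mathlib
import Summits.Ventures.PercRepro2.LocRows
import Summits.Ventures.PercRepro2.SwRow
import Summits.Ventures.PercRepro2.SwOut
import Summits.Ventures.PercRepro2.SwAllRow
import Summits.Ventures.PercRepro2.SwOutAll
import Summits.Ventures.PercRepro2.SwOutSeriesDefs

/-!
# Peeling a leaf inside an outside class (blind cell PercRepro2, night-4 g10, 2026-08-25;
proofs/NIGHT4-G10.md §2, Remark (i))

A LEAF `u` of the region is a vertex whose only edge is `e₁ = (u, p)` (`IsLeafAt`); deleting it
(`deleteLeaf`: `e₁` becomes a loop at the isolated `u`) is again an operation on the same edge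
type.  The class of `(G, U, ξ)` is the class of `(G − u, U ∖ {u}, ξ[e₁ ↦ false])` with the colour of
`e₁` free; the red cluster of `h` gains `e₁` exactly when `e₁` is red and `p` is in it (the TAG
`tagSub`).  THEOREM L (`card_le_of_leaf`): the rigid counting inequalities of the peeled class, for
every up-set, give those of the class — the leaf step of the induction of the cycle theorem.
-/

namespace Summit.Ventures.PercRepro2

namespace LocRows

open Hull

variable {V : Type*} {E : Type*} [Fintype E] [DecidableEq E]

open scoped Classical

/-- `u` is a LEAF with the single edge `e₁ = (u, p)`. -/
structure IsLeafAt (ends : E → Sym2 V) (u p : V) (e₁ : E) : Prop where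
  ends₁ : ends e₁ = s(u, p)
  up : u ≠ p
  only : ∀ e, u ∈ ends e → e = e₁

/-- The peeled graph `G − u`: the leaf edge becomes a loop at the isolated `u`. -/
noncomputable def deleteLeaf (ends : E → Sym2 V) (u : V) (e₁ : E) : E → Sym2 V :=
  Function.update ends e₁ s(u, u)

variable {ends : E → Sym2 V} {u p : V} {e₁ : E}

omit [Fintype E] in
/-- `e₁` is a loop at `u` in the peeled graph. -/
lemma deleteLeaf_apply_e₁ : deleteLeaf ends u e₁ e₁ = s(u, u) := by simp [deleteLeaf]

omit [Fintype E] in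
/-- The other edges are unchanged. -/
lemma deleteLeaf_apply_of_ne {e : E} (h₁ : e ≠ e₁) : deleteLeaf ends u e₁ e = ends e := by
  simp [deleteLeaf, Function.update_of_ne h₁]

omit [Fintype E] [DecidableEq E] in
/-- A vertex of an edge other than `e₁` is not the leaf. -/
lemma ne_u_of_mem_ends_leaf (hs : IsLeafAt ends u p e₁) {e : E} (h₁ : e ≠ e₁) {v : V}
    (hv : v ∈ ends e) : v ≠ u := by
  rintro rfl
  exact h₁ (hs.only e hv)

section Leaf

variable (hs : IsLeafAt ends u p e₁)
include hs

omit [Fintype E] in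
/-- `u` is isolated in the peeled graph. -/
lemma u_notMem_cluster_deleteLeaf {ω : Config E} {x : V} (hx : x ≠ u) :
    u ∉ cluster (deleteLeaf ends u e₁) ω x := by
  intro hu
  have key : u ∈ ({v | v ≠ u} : Set V) := by
    refine mem_of_conn_of_closed (ends := deleteLeaf ends u e₁) (ω := ω) ?_ hx hu
    intro a ha b hab
    obtain ⟨hne, e, _, hends⟩ := openGraph_adj.1 hab
    by_cases he₁ : e = e₁
    · subst e
      rw [deleteLeaf_apply_e₁, Sym2.eq_iff] at hends
      exact absurd (by rcases hends with ⟨h, h'⟩ | ⟨h, h'⟩ <;>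
        first | exact h.symm.trans h' | exact h'.symm.trans h) hne
    · rw [deleteLeaf_apply_of_ne he₁] at hends
      exact ne_u_of_mem_ends_leaf hs he₁ (by rw [hends]; exact Sym2.mem_mk_right a b)
  exact key rfl

omit [Fintype E] hs in
/-- A cluster of the peeled graph lies in the cluster of the original graph. -/
lemma cluster_deleteLeaf_subset {ω : Config E} (x : V) :
    cluster (deleteLeaf ends u e₁) ω x ⊆ cluster ends ω x := by
  intro v hv
  refine mem_of_conn_of_closed (ends := deleteLeaf ends u e₁) (ω := ω)
    (S := cluster ends ω x) ?_ (mem_cluster_self _ _ _) hv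
  intro a ha b hab
  obtain ⟨hne, e, he, hends⟩ := openGraph_adj.1 hab
  by_cases he₁ : e = e₁
  · subst e
    rw [deleteLeaf_apply_e₁, Sym2.eq_iff] at hends
    exact absurd (by rcases hends with ⟨h, h'⟩ | ⟨h, h'⟩ <;>
      first | exact h.symm.trans h' | exact h'.symm.trans h) hne
  · rw [deleteLeaf_apply_of_ne he₁] at hends
    exact mem_cluster_of_edge ha he hends

omit [Fintype E] in
/-- The cluster of the original graph lies in the peeled cluster, plus `u` when `e₁` is open and
`p` is there. -/
lemma cluster_subset_deleteLeaf {ω : Config E} {x : V} (hx : x ≠ u) :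
    cluster ends ω x ⊆
      cluster (deleteLeaf ends u e₁) ω x ∪
        {v | v = u ∧ ω e₁ = true ∧ p ∈ cluster (deleteLeaf ends u e₁) ω x} := by
  intro v hv
  refine mem_of_conn_of_closed (ends := ends) (ω := ω) ?_ (Or.inl (mem_cluster_self _ _ _)) hv
  intro a ha b hab
  obtain ⟨hne, e, he, hends⟩ := openGraph_adj.1 hab
  have hS : ∀ w, w ≠ u → w ∈ cluster (deleteLeaf ends u e₁) ω x ∪
      {v | v = u ∧ ω e₁ = true ∧ p ∈ cluster (deleteLeaf ends u e₁) ω x} →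
      w ∈ cluster (deleteLeaf ends u e₁) ω x := by
    intro w hw hwS
    rcases hwS with h | ⟨rfl, _⟩
    · exact h
    · exact absurd rfl hw
  by_cases he₁ : e = e₁
  · subst e
    rw [hs.ends₁, Sym2.eq_iff] at hends
    rcases hends with ⟨rfl, rfl⟩ | ⟨rfl, rfl⟩
    · rcases ha with h | ⟨_, _, hp⟩
      · exact absurd h (u_notMem_cluster_deleteLeaf hs hx)
      · exact Or.inl hp
    · exact Or.inr ⟨rfl, he, hS _ hs.up.symm ha⟩
  · have hau : a ≠ u := ne_u_of_mem_ends_leaf hs he₁ (by rw [hends]; exact Sym2.mem_mk_left a b)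
    have ha' := hS a hau ha
    refine Or.inl (mem_cluster_of_edge ha' he ?_)
    rw [deleteLeaf_apply_of_ne he₁]
    exact hends

omit [Fintype E] in
/-- **Peeling keeps the clusters on `V ∖ {u}`** (for any recolouring of the loop). -/
theorem mem_cluster_deleteLeaf_iff {ω : Config E} (b : Bool) {x v : V} (hx : x ≠ u) (hv : v ≠ u) :
    v ∈ cluster ends ω x ↔ v ∈ cluster (deleteLeaf ends u e₁) (Function.update ω e₁ b) x := by
  rw [cluster_update_of_loop (deleteLeaf_apply_e₁ (ends := ends) (u := u) (e₁ := e₁))]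
  constructor
  · intro h
    rcases cluster_subset_deleteLeaf hs hx h with h' | ⟨rfl, _⟩
    · exact h'
    · exact absurd rfl hv
  · exact fun h => cluster_deleteLeaf_subset x h

omit [Fintype E] in
/-- **`u` rides with `p` when its edge is open.** -/
theorem mem_cluster_deleteLeaf_u_iff {ω : Config E} (b : Bool) {x : V} (hx : x ≠ u) :
    u ∈ cluster ends ω x ↔
      (ω e₁ = true ∧ p ∈ cluster (deleteLeaf ends u e₁) (Function.update ω e₁ b) x) := by
  rw [cluster_update_of_loop (deleteLeaf_apply_e₁ (ends := ends) (u := u) (e₁ := e₁))]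
  constructor
  · intro h
    rcases cluster_subset_deleteLeaf hs hx h with h' | ⟨_, he, hp⟩
    · exact absurd h' (u_notMem_cluster_deleteLeaf hs hx)
    · exact ⟨he, hp⟩
  · rintro ⟨he, hp⟩
    have hp' : p ∈ cluster ends ω x := cluster_deleteLeaf_subset x hp
    exact mem_cluster_of_edge hp' he (ends_swap hs.ends₁)

omit [Fintype E] in
/-- The edges touching `U ∖ {u}` in the peeled graph are those touching `U` other than `e₁`. -/
lemma mem_touches_deleteLeaf_iff {U : Set V} {e : E} :
    e ∈ touches (deleteLeaf ends u e₁) (U \ {u}) ↔ e ∈ touches ends U ∧ e ≠ e₁ := by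
  by_cases he₁ : e = e₁
  · subst e
    simp only [ne_eq, not_true_eq_false, and_false, iff_false]
    rintro ⟨x, hx, y, hxy⟩
    rw [deleteLeaf_apply_e₁, Sym2.eq_iff] at hxy
    rcases hxy with ⟨rfl, _⟩ | ⟨_, rfl⟩ <;> exact hx.2 rfl
  · simp only [ne_eq, he₁, not_false_eq_true, and_true]
    constructor
    · rintro ⟨x, hx, y, hxy⟩
      rw [deleteLeaf_apply_of_ne he₁] at hxy
      exact ⟨x, hx.1, y, hxy⟩
    · rintro ⟨x, hx, y, hxy⟩
      have hxu : x ≠ u := ne_u_of_mem_ends_leaf hs he₁ (by rw [hxy]; exact Sym2.mem_mk_left x y)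
      exact ⟨x, ⟨hx, hxu⟩, y, by rw [deleteLeaf_apply_of_ne he₁]; exact hxy⟩

/-- **The class correspondence of the peel**: a configuration lies in the outside class of
`(G, U, ξ)` iff its canonical image (the loop recoloured `false`) lies in the outside class of
`(G − u, U ∖ {u}, ξ[e₁ ↦ false])`. -/
theorem mem_swOutSide_deleteLeaf_iff {U : Set V} {ξ : Config E} {l h o : V} (hu : u ∈ U)
    (huh : u ≠ h) (hul : u ≠ l) (huo : u ≠ o) {ζ : Config E} :
    ζ ∈ swOutSide ends l h o U ξ ↔
      Function.update ζ e₁ false ∈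
        swOutSide (deleteLeaf ends u e₁) l h o (U \ {u}) (Function.update ξ e₁ false) := by
  have hblue : blue (Function.update ζ e₁ false) = Function.update (blue ζ) e₁ true := by
    rw [blue_update]; rfl
  have hA : ∀ v, v ≠ u → (v ∈ cluster ends ζ l ↔
      v ∈ cluster (deleteLeaf ends u e₁) (Function.update ζ e₁ false) l) :=
    fun v hv => mem_cluster_deleteLeaf_iff hs false hul.symm hv
  have hB : ∀ v, v ≠ u → (v ∈ cluster ends (blue ζ) l ↔
      v ∈ cluster (deleteLeaf ends u e₁) (blue (Function.update ζ e₁ false)) l) := by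
    intro v hv
    rw [hblue]
    exact mem_cluster_deleteLeaf_iff hs true hul.symm hv
  have hT : ∀ v, v ≠ u → (v ∈ cluster ends ζ h ↔
      v ∈ cluster (deleteLeaf ends u e₁) (Function.update ζ e₁ false) h) :=
    fun v hv => mem_cluster_deleteLeaf_iff hs false huh.symm hv
  have hT' : ∀ v, v ≠ u → (v ∈ cluster ends (blue ζ) h ↔
      v ∈ cluster (deleteLeaf ends u e₁) (blue (Function.update ζ e₁ false)) h) := by
    intro v hv
    rw [hblue]
    exact mem_cluster_deleteLeaf_iff hs true huh.symm hv
  have he₁U : e₁ ∈ touches ends U := ⟨u, hu, p, hs.ends₁⟩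
  rw [mem_swOutSide, mem_swOutSide, mem_outClass, mem_outClass]
  simp only [tgtU, Finset.mem_filter, Finset.mem_univ, true_and, Set.mem_setOf_eq, hull,
    Set.mem_union, not_or]
  constructor
  · rintro ⟨⟨⟨hhA, hhB⟩, hoA, hoB⟩, hpin, hhull⟩
    refine ⟨⟨⟨?_, ?_⟩, ?_, ?_⟩, ?_, ?_⟩
    · exact fun h' => hhA ((hA h huh.symm).2 h')
    · exact fun h' => hhB ((hB h huh.symm).2 h')
    · exact (hA o huo.symm).1 hoA
    · exact fun h' => hoB ((hB o huo.symm).2 h')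
    · intro e he
      rw [mem_touches_deleteLeaf_iff hs] at he
      by_cases he₁ : e = e₁
      · subst e; simp
      · have heU : e ∉ touches ends U := fun h' => he ⟨h', he₁⟩
        rw [Function.update_of_ne he₁, Function.update_of_ne he₁]
        exact hpin e heU
    · intro v hv
      have hvu : v ≠ u := by
        rintro rfl
        rcases hv with hv | hv
        · exact u_notMem_cluster_deleteLeaf hs huh.symm hv
        · exact u_notMem_cluster_deleteLeaf hs huh.symm hv
      refine ⟨hhull ?_, hvu⟩
      rcases hv with hv | hv
      · exact Or.inl ((hT v hvu).2 hv)
      · exact Or.inr ((hT' v hvu).2 hv)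
  · rintro ⟨⟨⟨hhA, hhB⟩, hoA, hoB⟩, hpin, hhull⟩
    refine ⟨⟨⟨?_, ?_⟩, ?_, ?_⟩, ?_, ?_⟩
    · exact fun h' => hhA ((hA h huh.symm).1 h')
    · exact fun h' => hhB ((hB h huh.symm).1 h')
    · exact (hA o huo.symm).2 hoA
    · exact fun h' => hoB ((hB o huo.symm).1 h')
    · intro e he
      have he₁ : e ≠ e₁ := by rintro rfl; exact he he₁U
      have he' : e ∉ touches (deleteLeaf ends u e₁) (U \ {u}) := by
        rw [mem_touches_deleteLeaf_iff hs]; exact fun h' => he h'.1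
      have := hpin e he'
      rwa [Function.update_of_ne he₁, Function.update_of_ne he₁] at this
    · intro v hv
      by_cases hvu : v = u
      · exact hvu ▸ hu
      · refine (hhull ?_).1
        rcases hv with hv | hv
        · exact Or.inl ((hT v hvu).1 hv)
        · exact Or.inr ((hT' v hvu).1 hv)

end Leaf

end LocRows

end Summit.Ventures.PercRepro2
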